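import Summits.Ventures.CertifiedManyBodySolver.Downfold.S2Seam
import Literature.Computation.Certificates.BoxCoverCertificate
import HarnessLib

/-!
# The S1/S2 seam for MULTI-PRODUCER atlases: a one-band box's delivered box inside a
# kernel-checked union of certified cells (and declared gaps)

Venture CertifiedManyBodySolver; written by the S2 covering seat (cell `pub/hubbard-fast`,
hubbard-box-p2) next to `Downfold.S2Seam` (cell `pub/hubbard-downfold`, mod-1), which it only
composes with `Literature/Computation/Certificates/BoxCoverCertificate.lean`. Namespace
`Summit.Ventures.CertifiedManyBodySolver.Downfold`. Everything here is PROVED; no definition, no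
number, no physics. HONEST FRAMING: the words `W` are whatever the certified cells carry (energy
windows, ground-state correlator floors, …); a GAP cell carries nothing and its points are reported as
such ("undetermined: box not covered", ROUTER R5 / phase-map §14 rules) — never silently dropped.

The situation. Stage S2 certifies words CELL BY CELL, and the cells of record come from different
producers on different grids (the fast atlas rectangles, `2 × 2` tilings of a box engineer, half-`t'`
cells, another seat's `(U, n)` faces, …). A material's one-band box `B` (stage S1) has a delivered box
`Set.Icc (s2Lo eU eS eN) (s2Hi eU eS eN) ⊆ (Fin 3 → ℝ)` in the order `(U/t, t'/t, n)`
(`S2Seam.s2Coords_mem_Icc`). Whether that box lies in the union of the certified cells — and which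
part of it does not — is decided by a kd-tree certificate `t : KdCert ι` checked in the kernel
(`KdCert.check (cellLeaf …) … = true` by `decide +kernel`; generator
`pub/hubbard-fast/hubbard-box-p2/code/boxcover_cert.py`):

* `s2Lo_eq_ratVec / s2Hi_eq_ratVec` — the delivered-box corners ARE the casts of the rational vectors
  `![eU.encl.fst, eS.encl.fst, eN.encl.fst]` / `![….snd, …]` the certificate is checked against;
* `holdsOn_or_gap_of_kdCheck` — ROUTER R5 IN KERNEL FORM: cells tagged `certified j = true` carry `W`,
  the others are declared gaps; then on the one-band box: `W (s2Coords p) ∨ s2Coords p ∈ some gap cell`;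
* `holdsOn_of_kdCheck` — all cells certified: `W (s2Coords p)` on the box;
* `holdsOn_of_kdCheck₃` — the same with the cell words in the producers' scalar letters
  `∀ u s n, L₀ ≤ u → u ≤ H₀ → L₁ ≤ s → s ≤ H₁ → L₂ ≤ n → n ≤ H₂ → W₁ u s n`, conclusion
  `W₁ (p UOverT) (p tpOverT) (p filling)` on the box (the shape of `holdsOn_oneBand_of_cell`).
-/

namespace Summit.Ventures.CertifiedManyBodySolver.Downfold

open Literature.Computation.Certificates.BoxCovering
open Literature.Analysis.ValidatedNumerics (KdCert)

/-- The lower corner of the delivered box is the cast of the rational vector of the three entries'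
left end points. [folklore] -/
theorem s2Lo_eq_ratVec (eU eS eN : Entry) :
    s2Lo eU eS eN = fun k => ((![eU.encl.fst, eS.encl.fst, eN.encl.fst] k : ℚ) : ℝ) := by
  funext k; fin_cases k <;> rfl

/-- The upper corner of the delivered box is the cast of the rational vector of the three entries'
right end points. [folklore] -/
theorem s2Hi_eq_ratVec (eU eS eN : Entry) :
    s2Hi eU eS eN = fun k => ((![eU.encl.snd, eS.encl.snd, eN.encl.snd] k : ℚ) : ℝ) := by
  funext k; fin_cases k <;> rfl

/-- **Router R5 in kernel form (word, or inside a declared gap).** Let the one-band box `B` carry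
entries `eU, eS, eN` for `U/t`, `tp/t`, `n`; let cells `[L j, H j]` (`j : ι`, rational corners in the
order `(U/t, t'/t, n)`) be tagged by `certified : ι → Bool`, the certified ones carrying the word `W`;
and let a kd-tree certificate `t` for «delivered box ⊆ ⋃ cells» be accepted by the kernel. Then at
every parameter vector of the box: `W` holds, or the vector lies in one of the (finitely many,
explicitly listed) uncertified cells. [folklore] -/
theorem holdsOn_or_gap_of_kdCheck {B : OneBandBox} {eU eS eN : Entry} (hU : B .UOverT = some eU)
    (hS : B .tpOverT = some eS) (hN : B .filling = some eN) {ι : Type} (L H : ι → Fin 3 → ℚ)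
    (certified : ι → Bool) {t : KdCert ι}
    (hc : t.check (cellLeaf fun j => boxOfFn (L j) (H j))
      (boxOfFn ![eU.encl.fst, eS.encl.fst, eN.encl.fst] ![eU.encl.snd, eS.encl.snd, eN.encl.snd]) =
        true)
    {W : (Fin 3 → ℝ) → Prop}
    (hW : ∀ j, certified j = true →
      ∀ θ ∈ Set.Icc (fun k => ((L j k : ℚ) : ℝ)) (fun k => ((H j k : ℚ) : ℝ)), W θ) :
    HoldsOn (fun p : OneBandCoord → ℝ => W (s2Coords p) ∨ ∃ j, certified j = false ∧
      s2Coords p ∈ Set.Icc (fun k => ((L j k : ℚ) : ℝ)) (fun k => ((H j k : ℚ) : ℝ))) B := by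
  refine holdsOn_of_forall_s2Box hU hS hN (W := fun θ => W θ ∨ ∃ j, certified j = false ∧
    θ ∈ Set.Icc (fun k => ((L j k : ℚ) : ℝ)) (fun k => ((H j k : ℚ) : ℝ))) ?_
  rw [s2Lo_eq_ratVec, s2Hi_eq_ratVec]
  exact forall_mem_Icc_or_gap_of_kdCheck L H hc certified hW

/-- **All cells certified: the word on the one-band box.** With an accepted certificate for
«delivered box ⊆ ⋃ cells» and the word `W` on every cell, `W (s2Coords p)` holds on `B`.
[folklore] -/
theorem holdsOn_of_kdCheck {B : OneBandBox} {eU eS eN : Entry} (hU : B .UOverT = some eU)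
    (hS : B .tpOverT = some eS) (hN : B .filling = some eN) {ι : Type} (L H : ι → Fin 3 → ℚ)
    {t : KdCert ι}
    (hc : t.check (cellLeaf fun j => boxOfFn (L j) (H j))
      (boxOfFn ![eU.encl.fst, eS.encl.fst, eN.encl.fst] ![eU.encl.snd, eS.encl.snd, eN.encl.snd]) =
        true)
    {W : (Fin 3 → ℝ) → Prop}
    (hW : ∀ j, ∀ θ ∈ Set.Icc (fun k => ((L j k : ℚ) : ℝ)) (fun k => ((H j k : ℚ) : ℝ)), W θ) :
    HoldsOn (fun p : OneBandCoord → ℝ => W (s2Coords p)) B := by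
  refine holdsOn_of_forall_s2Box hU hS hN ?_
  rw [s2Lo_eq_ratVec, s2Hi_eq_ratVec]
  exact forall_mem_Icc_of_kdCheck L H hc hW

/-- **All cells certified, producers' scalar letters.** Cell `j` carries its word as
`∀ u s n, L j 0 ≤ u → u ≤ H j 0 → L j 1 ≤ s → s ≤ H j 1 → L j 2 ≤ n → n ≤ H j 2 → W₁ u s n` (corners
cast to `ℝ`); with an accepted certificate, `W₁ (p UOverT) (p tpOverT) (p filling)` holds on `B` —
the conclusion shape of `holdsOn_oneBand_of_cell`, now for a box covered by SEVERAL cells. [folklore] -/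
theorem holdsOn_of_kdCheck₃ {B : OneBandBox} {eU eS eN : Entry} (hU : B .UOverT = some eU)
    (hS : B .tpOverT = some eS) (hN : B .filling = some eN) {ι : Type} (L H : ι → Fin 3 → ℚ)
    {t : KdCert ι}
    (hc : t.check (cellLeaf fun j => boxOfFn (L j) (H j))
      (boxOfFn ![eU.encl.fst, eS.encl.fst, eN.encl.fst] ![eU.encl.snd, eS.encl.snd, eN.encl.snd]) =
        true)
    {W₁ : ℝ → ℝ → ℝ → Prop}
    (hW : ∀ j, ∀ u s n : ℝ, ((L j 0 : ℚ) : ℝ) ≤ u → u ≤ ((H j 0 : ℚ) : ℝ) →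
      ((L j 1 : ℚ) : ℝ) ≤ s → s ≤ ((H j 1 : ℚ) : ℝ) →
      ((L j 2 : ℚ) : ℝ) ≤ n → n ≤ ((H j 2 : ℚ) : ℝ) → W₁ u s n) :
    HoldsOn (fun p : OneBandCoord → ℝ => W₁ (p .UOverT) (p .tpOverT) (p .filling)) B := by
  intro p hp
  have hu := NonemptyInterval.mem_ratCast_iff.1 (hp _ _ hU)
  have hs := NonemptyInterval.mem_ratCast_iff.1 (hp _ _ hS)
  have hn := NonemptyInterval.mem_ratCast_iff.1 (hp _ _ hN)
  exact forall₃_of_kdCheck L H hc hW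
    (by simpa using hu.1) (by simpa using hu.2) (by simpa using hs.1) (by simpa using hs.2)
    (by simpa using hn.1) (by simpa using hn.2)

end Summit.Ventures.CertifiedManyBodySolver.Downfold
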